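import Mathlib.Algebra.BigOperators.Group.List.Basic
import Mathlib.Algebra.Order.BigOperators.Group.List
import Mathlib.Tactic.Linarith
import Mathlib.Tactic.Ring
import HarnessLib

/-!
# [OURS · L1 W4.2] σ-LAYER PHASE B′ — `Corridor3SigmaCureMultisetLaw`: the scheme-free MULTISET LAW of the CURE curve step and a badness count that STRICTLY DROPS
# (res-L1-w42-stub-1 DESIGN CHECK 2, 17:45Z; RULING v3.14-43 (KN) (R-a); for the 067-successor who types `bad`/M)

HONEST FRAMING. OURS, scheme-free bookkeeping (lists of natural numbers); no algebraic geometry, no named fact, NOT a statement of H. Hironaka's manuscript [Hironaka2017]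
nor of [CossartJannsenSaito2020]. AI-written; AI review is weaker than expert review.

THE LAW. At a cure CURVE step along a component `c` of the trace configuration on the regular surface (the blow-up of the surface along `c` is an isomorphism),
every member containing `c` loses ONE copy of `c`, members not containing `c` are unchanged, and the new exceptional member restricts to `c` with multiplicity `1`
(res-type-067 `exceptional_mul_controlledTransform_comap`, `comap_strictTransformHom_exceptional`). On the list `l` of the (positive) multiplicities of `c` in the
members containing it: `l ↦ cureStep l := (members with m ≥ 2, each m − 1) ++ [1]`. The naive count `Σ m − 1` does NOT drop when a single member carries `c` with
multiplicity `m ≥ 2` (`[m] ↦ [m − 1, 1]`, sum unchanged). The count **`μ l := 2·Σ m − 1 − #l`** `= (Σ m − 1) + Σ (m − 1)` drops by `#l + #{m ≥ 2} − 1 ≥ 1` at every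
step on a BAD component (`Σ m ≥ 2`) and vanishes exactly on `[1]` (the component carried once, reduced).

## Contents (namespace `…Theorems.SigmaMaxModificationsCorridor3.Sigma.CureLaw`)

* `peel l` (members keeping `c`: `m − 1` for `m ≥ 2`), `cureStep l := peel l ++ [1]`; `sum_peel` (`Σ peel = Σ l − #l` for positive entries), `length_peel`
  (`= #{m ≥ 2}`), `cureStep_pos` (entries stay positive).
* `μ l := 2 * l.sum − (l.length + 1)` with `μ_eq` (no truncation for positive non-empty `l`), **`μ_cureStep_add`** (`μ l = μ (cureStep l) + (#l + #{m ≥ 2} − 1)`),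
  **`μ_cureStep_lt`** (`2 ≤ Σ l` ⇒ `μ (cureStep l) < μ l`), `μ_eq_zero_iff` (`μ l = 0 ↔ l = [1]` for positive non-empty `l`), `two_le_sum_iff_ne_singleton_one`.

VACUITY SELF-CHECK. `[2] ↦ [1, 1] ↦ [1]` with `μ = 2, 1, 0`; `[3, 1] ↦ [2, 1] ↦ [1, 1] ↦ [1]` with `μ = 5, 3, 1, 0` (`example`s below, by `decide`).
-/

set_option linter.dupNamespace false -- mandated namespace of this single-conjunct summit

namespace Summit.ResolutionOfSingularities.ResolutionOfSingularities.Theorems.SigmaMaxModificationsCorridor3.Sigma.CureLaw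

/-- [OURS · L1 W4.2] **The members still containing `c` after the cure step**, with their new multiplicities: `m − 1` for every member with `m ≥ 2` (members with
`m = 1` lose their last copy and drop out). NOT a statement of the manuscript. [folklore] -/
def peel (l : List ℕ) : List ℕ :=
  (l.filter fun m => 2 ≤ m).map fun m => m - 1

/-- [OURS · L1 W4.2] **THE CURE STEP on the multiplicity list of a component**: peel one copy from every member, then adjoin the new exceptional member with
multiplicity `1`. NOT a statement of the manuscript. [folklore] -/
def cureStep (l : List ℕ) : List ℕ :=
  peel l ++ [1]

/-- [OURS · L1 W4.2] **THE BADNESS COUNT of one component**: `μ l = 2·Σ m − 1 − #l` `= (Σ m − 1) + Σ_j (m_j − 1)` (shared-ness plus non-reducedness). NOT a statement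
of the manuscript. [folklore] -/
def μ (l : List ℕ) : ℕ :=
  2 * l.sum - (l.length + 1)

/-- Peeling the empty list. [folklore] -/
@[simp] theorem peel_nil : peel [] = [] := rfl

/-- A member with multiplicity `≥ 2` keeps the component with one copy less. [folklore] -/
@[simp] theorem peel_cons_of_two_le {m : ℕ} (hm : 2 ≤ m) (l : List ℕ) : peel (m :: l) = (m - 1) :: peel l := by
  simp [peel, hm]

/-- A member with multiplicity `1` (or `0`) loses the component. [folklore] -/
@[simp] theorem peel_cons_of_lt_two {m : ℕ} (hm : m < 2) (l : List ℕ) : peel (m :: l) = peel l := by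
  simp [peel, Nat.not_le.mpr hm]

/-- The peeled list counts the members with multiplicity at least two. [folklore] -/
theorem length_peel (l : List ℕ) : (peel l).length = (l.filter fun m => 2 ≤ m).length := by
  simp [peel]

/-- **Sum law**: for positive multiplicities, `Σ (peel l) + #l = Σ l`. [folklore] -/
theorem sum_peel_add_length (l : List ℕ) (hpos : ∀ m ∈ l, 1 ≤ m) : (peel l).sum + l.length = l.sum := by
  induction l with
  | nil => simp
  | cons m t ih =>
    have hm : 1 ≤ m := hpos m (by simp)
    have ht : ∀ m ∈ t, 1 ≤ m := fun m hm' => hpos m (by simp [hm'])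
    by_cases h2 : 2 ≤ m
    · rw [peel_cons_of_two_le h2, List.sum_cons, List.sum_cons, List.length_cons, ← ih ht]
      omega
    · have hm1 : m = 1 := by omega
      subst hm1
      rw [peel_cons_of_lt_two (by norm_num), List.sum_cons, List.length_cons, ← ih ht]
      omega

/-- Entries of the peeled list are positive. [folklore] -/
theorem peel_pos (l : List ℕ) : ∀ m ∈ peel l, 1 ≤ m := by
  intro m hm
  simp only [peel, List.mem_map, List.mem_filter, decide_eq_true_eq] at hm
  obtain ⟨a, ⟨-, ha⟩, rfl⟩ := hm
  omega

/-- Entries stay positive under the cure step. [folklore] -/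
theorem cureStep_pos (l : List ℕ) : ∀ m ∈ cureStep l, 1 ≤ m := by
  intro m hm
  simp only [cureStep, List.mem_append, List.mem_singleton] at hm
  rcases hm with hm | rfl
  · exact peel_pos l m hm
  · exact le_rfl

/-- The number of members with multiplicity at least two is at most the number of members. [folklore] -/
theorem length_filter_two_le_le (l : List ℕ) : (l.filter fun m => 2 ≤ m).length ≤ l.length :=
  List.length_filter_le _ _

/-- **THE DROP, EXACTLY**: `μ l = μ (cureStep l) + (#l + #{m ≥ 2} − 1)` for a non-empty list of positive multiplicities. [folklore] -/
theorem μ_cureStep_add (l : List ℕ) (hpos : ∀ m ∈ l, 1 ≤ m) (hne : l ≠ []) :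
    μ l = μ (cureStep l) + (l.length + (l.filter fun m => 2 ≤ m).length - 1) := by
  have hsum := sum_peel_add_length l hpos
  have hlen : 1 ≤ l.length := List.length_pos_iff.mpr hne
  have hk2 := length_filter_two_le_le l
  have hS : l.length ≤ l.sum := by
    have := List.length_le_sum_of_one_le l hpos
    simpa using this
  have hP : (peel l).length ≤ (peel l).sum := by
    have := List.length_le_sum_of_one_le (peel l) (peel_pos l)
    simpa using this
  rw [length_peel] at hP
  have hμ' : μ (cureStep l) = 2 * ((peel l).sum + 1) - ((l.filter fun m => 2 ≤ m).length + 1 + 1) := by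
    simp only [μ, cureStep, List.sum_append, List.sum_cons, List.sum_nil, List.length_append, List.length_cons, List.length_nil,
      length_peel]
    omega
  rw [hμ', μ]
  omega

/-- **THE BADNESS COUNT STRICTLY DROPS AT EVERY CURE STEP ON A BAD COMPONENT** (`Σ m ≥ 2`: shared or non-reduced). [folklore] -/
theorem μ_cureStep_lt (l : List ℕ) (hpos : ∀ m ∈ l, 1 ≤ m) (hbad : 2 ≤ l.sum) : μ (cureStep l) < μ l := by
  have hne : l ≠ [] := by rintro rfl; simp at hbad
  have h := μ_cureStep_add l hpos hne
  -- `#l + #{m ≥ 2} ≥ 2`: either two members, or one member with multiplicity `≥ 2`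
  have hk : 2 ≤ l.length + (l.filter fun m => 2 ≤ m).length := by
    match l, hne, hbad with
    | [m], _, hbad =>
      simp only [List.sum_cons, List.sum_nil, add_zero] at hbad
      simp [hbad]
    | m :: m' :: t, _, _ => simp only [List.length_cons]; omega
  omega

/-- **`μ = 0` iff the component is carried ONCE with multiplicity ONE** (for a non-empty list of positive multiplicities). [folklore] -/
theorem μ_eq_zero_iff (l : List ℕ) (hpos : ∀ m ∈ l, 1 ≤ m) (hne : l ≠ []) : μ l = 0 ↔ l = [1] := by
  constructor
  · intro h
    have hS : l.length ≤ l.sum := by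
      have := List.length_le_sum_of_one_le l hpos
      simpa using this
    have hlen : 1 ≤ l.length := List.length_pos_iff.mpr hne
    unfold μ at h
    -- `2 Σ ≤ #l + 1` with `#l ≤ Σ` forces `Σ = #l = 1`
    have hsum1 : l.sum = 1 := by omega
    have hlen1 : l.length = 1 := by omega
    match l, hlen1, hsum1 with
    | [m], _, hm => simp only [List.sum_cons, List.sum_nil, add_zero] at hm; simp [hm]
  · rintro rfl
    rfl

/-- A non-empty list of positive multiplicities is bad (`Σ ≥ 2`) iff it is not `[1]`. [folklore] -/
theorem two_le_sum_iff_ne_singleton_one (l : List ℕ) (hpos : ∀ m ∈ l, 1 ≤ m) (hne : l ≠ []) : 2 ≤ l.sum ↔ l ≠ [1] := by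
  constructor
  · rintro h rfl
    simp at h
  · intro h
    have hS : l.length ≤ l.sum := by
      have := List.length_le_sum_of_one_le l hpos
      simpa using this
    have hlen : 1 ≤ l.length := List.length_pos_iff.mpr hne
    by_contra hlt
    have hsum1 : l.sum = 1 := by omega
    have hlen1 : l.length = 1 := by omega
    apply h
    match l, hlen1, hsum1 with
    | [m], _, hm => simp only [List.sum_cons, List.sum_nil, add_zero] at hm; simp [hm]

/-- Self-check: `[2] ↦ [1, 1] ↦ [1]`, `μ = 2, 1, 0`. [folklore] -/
example : cureStep [2] = [1, 1] ∧ cureStep [1, 1] = [1] ∧ μ [2] = 2 ∧ μ [1, 1] = 1 ∧ μ [1] = 0 := by decide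

/-- Self-check: `[3, 1] ↦ [2, 1] ↦ [1, 1] ↦ [1]`, `μ = 5, 3, 1, 0`. [folklore] -/
example : cureStep [3, 1] = [2, 1] ∧ cureStep [2, 1] = [1, 1] ∧ μ [3, 1] = 5 ∧ μ [2, 1] = 3 := by decide

end Summit.ResolutionOfSingularities.ResolutionOfSingularities.Theorems.SigmaMaxModificationsCorridor3.Sigma.CureLaw
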